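import Summits.HubbardSuperconductivity.HubbardSuperconductivity.Theorems.MesoscopicPairOrder.Negative.StonerWeakCoupling
import HarnessLib

/-!
# Crux `MesoscopicPairOrder` (stmt-HubbardSuperconductivity-7331), Negative side:
# the CHEMICAL-POTENTIAL-SHIFTED Stoner spin ceiling (parametric in `μ < t`)

Line `redirect_birth` (lead c10). `StonerWeakCoupling.lean` (lead c9) excluded nearly saturated sector ground
states (the hypothesis of the refuter instruments `pointwise_false_of_nearlySaturated`,
`fluctuationFloorAt_false_of_nearlySaturated`) for `U ≤ 1/2`, bounding the polarised kinetic energy through the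
negative part of the band, i.e. at chemical potential `0` — the right Lagrange multiplier at HALF filling only.
Here the multiplier is freed:
* `posPart_sub_le_sq_div`, `sum_posPart_sub_torusBand_le` — `(μ - ε)₊ ≤ (ε - t)²/(4(t - μ))` (`t > μ`), hence
  `Σ_k (μ - ε_L(k))₊ ≤ L²(4 + t²)/(4(t - μ))` from the exact band moments `Σ ε = 0`, `Σ ε² = 4L²` (optimal in
  `t, μ`: the Lagrangian floor `-2√(ρ(1-ρ)) L²` of the one-band bathtub at density `ρ`, versus `-L²` at `μ = 0`);
* `re_expect_hubbardTorus_zero_ge_shift` — `Re⟨φ, H₀φ⟩ ≥ (μ a - L²(4+t²)/(4(t-μ)) - 4b)‖φ‖²` on Lieb's sector `(a, b)`;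
* `shifted_spin_le_of_groundState` / `shifted_spin_le_of_pairedSea` — the parametric Stoner ceiling
  **`(μ + 4)(n - S) ≥ 2μ n - L²(4+t²)/(4(t-μ)) - 2Σ_{k∈l} ε_L(k) - U n`** for every ground multiplet of spin `S`
  of the `(2n, S^z = 0)` sector and every `n`-momentum paired Fermi sea `l` (`μ = 0, t = 2` is
  `four_spin_le_of_pairedSea`; `μ → 4` is the band-edge bound `eight_spin_le_of_pairedSea`);
The lattice-sum evaluation (no near-saturation for `U ≤ 6/5` on `δ ∈ [1/10, 3/10]`, `n - S ≥ L²/200` for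
`L ≥ 4000`) is the companion file `StonerModerateCoupling.lean`.
Sources: E. C. Stoner, Proc. R. Soc. A 165 (1938) 372; E. H. Lieb, PRL 62 (1989) 1201; H. Tasaki,
Prog. Theor. Phys. 99 (1998) 489, §5; E. H. Lieb, M. Loss, *Analysis* (2001) Thm 1.14 (bathtub). Folklore
finite-dimensional statements; no definition, no named fact, no sorry.
-/

noncomputable section

-- the summit namespace repeats the problem name by design (D-0017)
set_option linter.dupNamespace false

namespace Summit.HubbardSuperconductivity.HubbardSuperconductivity.Theorems.MesoscopicPairOrder.Negative

open Matrix Finset Filter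
open Literature.Probability.LatticeModels Literature.MathematicalPhysics.QuantumLattice
open scoped ComplexOrder ComplexConjugate

section Shifted

variable {L : ℕ} [NeZero L]

/-! ### The shifted hinge and its band sum -/

omit [NeZero L] in
/-- **Tangent-parabola majorant of the hinge**: `max(μ - ε, 0) ≤ (ε - t)²/(4(t - μ))` for `t > μ`
(`(ε - t)² - 4(t - μ)(μ - ε) = (ε + t - 2μ)² ≥ 0`). [folklore] -/
theorem posPart_sub_le_sq_div {μ t : ℝ} (hμt : μ < t) (ε : ℝ) :
    max (μ - ε) 0 ≤ (ε - t) ^ 2 / (4 * (t - μ)) := by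
  have ht : 0 < 4 * (t - μ) := by linarith
  refine max_le ?_ (div_nonneg (sq_nonneg _) ht.le)
  rw [le_div_iff₀ ht]
  nlinarith [sq_nonneg (ε + t - 2 * μ)]

/-- **`Σ_k (μ - ε_L(k))₊ ≤ L²(4 + t²)/(4(t - μ))`** on the `L × L` torus (`L ≥ 3`, `t > μ`): sum the tangent
parabola using `Σ_k ε_L(k) = 0` and `Σ_k ε_L(k)² = 4L²`. [folklore] -/
theorem sum_posPart_sub_torusBand_le (hL : 3 ≤ L) {μ t : ℝ} (hμt : μ < t) :
    ∑ k : TorusSite 2 L, max (μ - torusBand L k) 0 ≤ (L : ℝ) ^ 2 * (4 + t ^ 2) / (4 * (t - μ)) := by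
  have hcard : (Finset.univ : Finset (TorusSite 2 L)).card = L ^ 2 := by
    simp [Finset.card_univ, Fintype.card_pi, ZMod.card]
  calc ∑ k : TorusSite 2 L, max (μ - torusBand L k) 0
      ≤ ∑ k : TorusSite 2 L, (torusBand L k - t) ^ 2 / (4 * (t - μ)) :=
        Finset.sum_le_sum fun k _ => posPart_sub_le_sq_div hμt _
    _ = ((∑ k : TorusSite 2 L, torusBand L k ^ 2) - 2 * t * (∑ k : TorusSite 2 L, torusBand L k) +
          (L : ℝ) ^ 2 * t ^ 2) / (4 * (t - μ)) := by
        rw [← Finset.sum_div]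
        congr 1
        have e : ∀ k : TorusSite 2 L, (torusBand L k - t) ^ 2 =
            torusBand L k ^ 2 - 2 * t * torusBand L k + t ^ 2 := fun k => by ring
        simp_rw [e]
        rw [Finset.sum_add_distrib, Finset.sum_sub_distrib, ← Finset.mul_sum, Finset.sum_const, hcard,
          nsmul_eq_mul]
        push_cast
        ring
    _ = (L : ℝ) ^ 2 * (4 + t ^ 2) / (4 * (t - μ)) := by
        rw [sum_torusBand_sq hL, sum_torusBand_eq_zero (by omega)]
        ring

/-! ### Kinetic energy on a polarised sector at chemical potential `μ` -/

/-- **`Re⟨φ, H₀φ⟩ ≥ (μ a - L²(4+t²)/(4(t-μ)) - 4b)‖φ‖²` on Lieb's sector `(a, b)`** (`L ≥ 3`, `t > μ`): the `↑`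
part `Σ_k ε_k x_k ≥ μ Σ_k x_k - Σ_k (μ - ε_k)₊ ‖φ‖² = μ a ‖φ‖² - Σ_k (μ - ε_k)₊ ‖φ‖²` (`0 ≤ x_k ≤ ‖φ‖²`,
`sum_posPart_sub_torusBand_le`), the `↓` part `≥ -4b‖φ‖²`. Lieb–Loss (2001) Thm 1.14 (the Lagrangian form
of the bathtub principle). [folklore] -/
theorem re_expect_hubbardTorus_zero_ge_shift (hL : 3 ≤ L) {a b : ℕ}
    {φ : Fock (Orb (FermionTorus 2 L))} (hφ : IsInSector a b φ) {μ t : ℝ} (hμt : μ < t) :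
    (μ * a - (L : ℝ) ^ 2 * (4 + t ^ 2) / (4 * (t - μ)) - 4 * b) * (star φ ⬝ᵥ φ).re ≤
      (star φ ⬝ᵥ (hubbardTorus 2 L 1 0 *ᵥ φ)).re := by
  rw [hubbardTorus_zero_eq_sum_momentumNumber hL, Matrix.sum_mulVec, dotProduct_sum, Complex.re_sum]
  have hsplit : ∀ k : TorusSite 2 L,
      (star φ ⬝ᵥ ((∑ σ : Fin 2, ((torusBand L k : ℝ) : ℂ) • momentumNumber k σ) *ᵥ φ)).re =
        torusBand L k * (star φ ⬝ᵥ (momentumNumber k 0 *ᵥ φ)).re +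
          torusBand L k * (star φ ⬝ᵥ (momentumNumber k 1 *ᵥ φ)).re := by
    intro k
    rw [Matrix.sum_mulVec, dotProduct_sum, Complex.re_sum, Fin.sum_univ_two]
    simp only [Fin.isValue, Matrix.smul_mulVec, dotProduct_smul, smul_eq_mul, Complex.re_ofReal_mul]
  simp only [hsplit, Finset.sum_add_distrib]
  have hup := sum_re_expect_momentumNumber_up hφ
  have hdown := sum_re_expect_momentumNumber_down hφ
  have hnorm : 0 ≤ (star φ ⬝ᵥ φ).re := (Complex.nonneg_iff.1 (dotProduct_star_self_nonneg φ)).1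
  -- `↑`: `ε x ≥ μ x - max(μ - ε, 0) ‖φ‖²` termwise
  have h1 : μ * (a * (star φ ⬝ᵥ φ).re) -
      (∑ k : TorusSite 2 L, max (μ - torusBand L k) 0) * (star φ ⬝ᵥ φ).re ≤
      ∑ k : TorusSite 2 L, torusBand L k * (star φ ⬝ᵥ (momentumNumber k 0 *ᵥ φ)).re := by
    rw [← hup, Finset.mul_sum, Finset.sum_mul, ← Finset.sum_sub_distrib]
    refine Finset.sum_le_sum fun k _ => ?_
    have hx := re_expect_momentumNumber_mem_Icc k 0 φ
    by_cases hε : μ ≤ torusBand L k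
    · rw [max_eq_right (by linarith)]
      nlinarith [hx.1]
    · push Not at hε
      rw [max_eq_left (by linarith)]
      nlinarith [hx.2]
  have hpos := sum_posPart_sub_torusBand_le (L := L) hL hμt
  -- `↓`: `Σ ε x ≥ -4 b ‖φ‖²`
  have h2 : -(4 : ℝ) * (b * (star φ ⬝ᵥ φ).re) ≤
      ∑ k : TorusSite 2 L, torusBand L k * (star φ ⬝ᵥ (momentumNumber k 1 *ᵥ φ)).re := by
    rw [← hdown, Finset.mul_sum]
    refine Finset.sum_le_sum fun k _ => ?_
    have hx := re_expect_momentumNumber_mem_Icc k 1 φ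
    have hε := neg_four_le_torusBand L k
    nlinarith [hx.1, hx.2]
  nlinarith [mul_le_mul_of_nonneg_right hpos hnorm]

/-! ### The parametric Stoner ceiling -/

/-- **SHIFTED SPIN CEILING** (`U ≥ 0`, `L ≥ 3`, `t > μ`, ground state of the `(2n, S^z = 0)` sector with
`S² = S(S+1)`, `S ≤ n`): `μ(n + S) - L²(4+t²)/(4(t-μ)) - 4(n - S) ≤ E₀` (ladder transfer
`minEnergyOn_ge_of_polarisedBound` of `re_expect_hubbardTorus_zero_ge_shift` on `(n + S, n - S)`). [folklore] -/
theorem shifted_spin_le_of_groundState (hL : 3 ≤ L) {U : ℝ} (hU : 0 ≤ U) {n S : ℕ} (hS : S ≤ n)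
    {ψ : Fock (Orb (FermionTorus 2 L))} (hgs : IsGroundStateInSector (hubbardTorus 2 L 1 U) (2 * n) 0 ψ)
    (hspin : spinSq *ᵥ ψ = (((S : ℝ) * ((S : ℝ) + 1) : ℝ) : ℂ) • ψ) {μ t : ℝ} (hμt : μ < t) :
    μ * ((n : ℝ) + S) - (L : ℝ) ^ 2 * (4 + t ^ 2) / (4 * (t - μ)) - 4 * ((n : ℝ) - S) ≤
      (hubbardTorus 2 L 1 U).minEnergyOn (szSector (Λ := FermionTorus 2 L) (2 * n) 0) := by
  have h := minEnergyOn_ge_of_polarisedBound (L := L) hU hS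
    (c₀ := μ * ((n + S : ℕ) : ℝ) - (L : ℝ) ^ 2 * (4 + t ^ 2) / (4 * (t - μ)) - 4 * ((n - S : ℕ) : ℝ))
    (fun φ hφ => re_expect_hubbardTorus_zero_ge_shift hL hφ hμt) hgs hspin
  rw [Nat.cast_sub hS, Nat.cast_add] at h
  exact h

/-- **THE PARAMETRIC STONER CRITERION.** For `U ≥ 0`, `L ≥ 3`, `t > μ`, a ground state `ψ` of the
`(2n, S^z = 0)` sector of `hubbardTorus 2 L 1 U` with `S² ψ = S(S+1) ψ`, `S ≤ n`, and ANY duplicate-free list `l`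
of `n` momenta (paired Fermi sea `Φ_l` as trial vector: kinetic energy `2Σ_l ε`, at most `n` doublons):
`(μ + 4)(n - S) ≥ 2μ n - L²(4+t²)/(4(t-μ)) - 2 Σ_{k∈l} ε_L(k) - U n`. At `μ = 0`, `t = 2` this is
`four_spin_le_of_pairedSea`; the band-edge bound `eight_spin_le_of_pairedSea` is its `μ → 4` limit.
Stoner (1938); Tasaki (1998) §5. [folklore] -/
theorem shifted_spin_le_of_pairedSea (hL : 3 ≤ L) {U : ℝ} (hU : 0 ≤ U) {n S : ℕ} (hS : S ≤ n)
    {ψ : Fock (Orb (FermionTorus 2 L))} (hgs : IsGroundStateInSector (hubbardTorus 2 L 1 U) (2 * n) 0 ψ)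
    (hspin : spinSq *ᵥ ψ = (((S : ℝ) * ((S : ℝ) + 1) : ℝ) : ℂ) • ψ)
    {l : List (TorusSite 2 L)} (hl : l.Nodup) (hlen : l.length = n) {μ t : ℝ} (hμt : μ < t) :
    2 * μ * n - (L : ℝ) ^ 2 * (4 + t ^ 2) / (4 * (t - μ)) - 2 * ∑ k ∈ l.toFinset, torusBand L k - U * n ≤
      (μ + 4) * ((n : ℝ) - S) := by
  have h := shifted_spin_le_of_groundState hL hU hS hgs hspin hμt
  set Φ : Fock (Orb (FermionTorus 2 L)) :=
    (List.prod (List.map (fun k : TorusSite 2 L => (pairMode k)ᴴ) l)) *ᵥ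
      (vacuum : Fock (Orb (FermionTorus 2 L))) with hΦ_def
  have hΦmem : Φ ∈ szSector (Λ := FermionTorus 2 L) (2 * n) 0 := by
    have h := pairedState_mem_szSector (L := L) l
    rwa [hlen] at h
  have hΦ1 : star Φ ⬝ᵥ Φ = 1 := star_pairedState_dotProduct_self hl
  have hH : (hubbardTorus 2 L 1 U).IsHermitian := LiebThm1.hamiltonian_isHermitian _ 1 U
  have hvar := minEnergyOn_le_rayleigh_of_mem hH _ hΦmem hΦ1
  have hkin : (star Φ ⬝ᵥ (hubbardTorus 2 L 1 0 *ᵥ Φ)).re = 2 * ∑ k ∈ l.toFinset, torusBand L k :=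
    re_expect_hubbardTorus_zero_pairedState hL hl
  have hsec : IsInSector n n Φ := (mem_szSector_two_mul_zero_iff n Φ).1 hΦmem
  have hint := re_expect_interaction_le_down hsec
  rw [hΦ1, Complex.one_re, mul_one] at hint
  have hsplit : (star Φ ⬝ᵥ (hubbardTorus 2 L 1 U *ᵥ Φ)).re =
      (star Φ ⬝ᵥ (hubbardTorus 2 L 1 0 *ᵥ Φ)).re +
        U * (star Φ ⬝ᵥ ((∑ x : FermionTorus 2 L, numberOp x 0 * numberOp x 1 :
          Matrix (Finset (Orb (FermionTorus 2 L))) _ ℂ) *ᵥ Φ)).re := by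
    rw [hubbardTorus_eq_zero_add_smul_interaction U, add_mulVec, Matrix.smul_mulVec, dotProduct_add,
      dotProduct_smul, smul_eq_mul, Complex.add_re, Complex.re_ofReal_mul]
  rw [hsplit, hkin] at hvar
  nlinarith [mul_le_mul_of_nonneg_left hint hU]

end Shifted

end Summit.HubbardSuperconductivity.HubbardSuperconductivity.Theorems.MesoscopicPairOrder.Negative
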